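import Mathlib
import HarnessLib
import Summits.RiemannHypothesis.RiemannHypothesis.Theorems.IntegerScrewCouplingDoob
import Summits.RiemannHypothesis.RiemannHypothesis.Theorems.IntegerScrewResolventLaplace

/-!
# Route `IntegerScrew` — PIVOT-LAW 13.10 (v) in full: the reciprocal window floor is the LAPLACE TRANSFORM of
# the `(1,1)` entry of `e^{tN_M}`: `1/f_M(a) = ∫₀^∞ e^{−at}(e^{tN_M})₁₁ dt` for every `a > ν`, `ν` any bound of
# the quadratic form of `N_M` (so for `a > log M + 6` always, and for `a = log M + s`, `s ≥ 0`, once `M` is large)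

Assembles `IntegerScrewCouplingForm` (`f_M(a) = 1/[(aI − N_M)⁻¹]₁₁`), `IntegerScrewResolventLaplace`
(`[(aI − A)⁻¹]_{ij} = ∫₀^∞e^{−at}(e^{tA})_{ij}dt` under entrywise growth) and `IntegerScrewSemigroupComparison`
(the diagonal of `e^{tS}` for symmetric `S`) into the statement PIVOT-LAW 13.45 starts from:

* `abs_exp_smul_apply_le_of_form_le` — symmetric `S`, `cᵀSc ≤ λ‖c‖²`: `|(e^{tS})_{kj}| ≤ e^{λt}` (`t ≥ 0`;
  Cauchy–Schwarz on `(e^{tS})_{kj} = Σ_m (e^{(t/2)S})_{mk}(e^{(t/2)S})_{mj}`);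
* `inv_apply_eq_integral_laplace_of_form_le` — hence the resolvent identity for symmetric `S` and `a > λ`;
* `windowFloor_inv_eq_integral` — `1/f_M(a) = ∫₀^∞ e^{−at}(e^{tN_M})₁₁ dt` for `a > ν ≥` the form of `N_M`;
  `windowFloor_inv_eq_integral_of_lt` (`a > log M + 6`, every `M ≥ 1`), `windowFloor_inv_eq_integral_eventually`
  (`a = log M + s`, every `s ≥ 0`, all large `M` — PROP. N2);
* `exp_couplingMatrix_apply_self_le_tail` — the spectral tail bound `(e^{(t+1)N_M})₁₁ ≤ e^{νt}(e^{N_M})₁₁`.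

RH-free; nothing here bears on the truth of RH.  References: PIVOT-LAW §13.10 (v), §13.45 (rh-explicit A6-PIVOT);
M. Suzuki, J. Lond. Math. Soc. (2) 108 (2023) 1448–1487 [Suzuki2023] for the screw matrices.
-/

noncomputable section

-- D-0017: `Summit.<S>.<S>.…` is the designed namespace of a single-problem summit.
set_option linter.dupNamespace false

namespace Summit.RiemannHypothesis.RiemannHypothesis.Theorems.IntegerScrew

open scoped Matrix.Norms.Operator
open NormedSpace Matrix Finset Filter MeasureTheory Set

/-! ### Entry bound for symmetric semigroups under a form bound -/

section Symmetric

variable {ι : Type*} [Fintype ι] [DecidableEq ι]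

/-- For a real symmetric `S` with `cᵀSc ≤ λ‖c‖²` for all `c`: every entry satisfies `|(e^{tS})_{kj}| ≤ e^{λt}`
(`t ≥ 0`). -/
theorem abs_exp_smul_apply_le_of_form_le {S : Matrix ι ι ℝ} (hS : S.IsHermitian) {lam : ℝ}
    (hform : ∀ c : ι → ℝ, c ⬝ᵥ (S *ᵥ c) ≤ lam * (c ⬝ᵥ c)) {t : ℝ} (ht : 0 ≤ t) (k j : ι) :
    |(exp (t • S)) k j| ≤ Real.exp (lam * t) := by
  set E : Matrix ι ι ℝ := exp ((t / 2) • S) with hE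
  have hsym : ∀ a b, E a b = E b a := fun a b => by
    have h := congrFun (congrFun (exp_smul_transpose_of_isHermitian hS (t / 2)) b) a
    rw [transpose_apply] at h
    exact h
  have hmul : exp (t • S) = E * E := by
    rw [hE, ← exp_add_smul_eq_mul, show t / 2 + t / 2 = t by ring]
  have hentry : (exp (t • S)) k j = ∑ m, E m k * E m j := by
    rw [hmul, mul_apply]
    exact Finset.sum_congr rfl fun m _ => by rw [hsym k m]
  -- Cauchy–Schwarz: (Σ_m E_mk E_mj)² ≤ (Σ E_mk²)(Σ E_mj²) = (e^{tS})_kk (e^{tS})_jj ≤ (e^{λt})²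
  have hkk : ∑ m, (E m k) ^ 2 = (exp (t • S)) k k := by
    have h := exp_smul_apply_self_eq_sum_sq hS (t / 2) k
    rw [show t / 2 + t / 2 = t by ring] at h
    exact h.symm
  have hjj : ∑ m, (E m j) ^ 2 = (exp (t • S)) j j := by
    have h := exp_smul_apply_self_eq_sum_sq hS (t / 2) j
    rw [show t / 2 + t / 2 = t by ring] at h
    exact h.symm
  have hCS := Finset.sum_mul_sq_le_sq_mul_sq Finset.univ (fun m => E m k) (fun m => E m j)
  rw [← hentry, hkk, hjj] at hCS
  have hk1 := exp_smul_apply_self_le_exp hS hform ht k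
  have hj1 := exp_smul_apply_self_le_exp hS hform ht j
  have hk0 := exp_smul_apply_self_nonneg hS t k
  have hj0 := exp_smul_apply_self_nonneg hS t j
  refine abs_le_of_sq_le_sq ?_ (Real.exp_pos _).le
  calc (exp (t • S)) k j ^ 2 ≤ (exp (t • S)) k k * (exp (t • S)) j j := hCS
    _ ≤ Real.exp (lam * t) * Real.exp (lam * t) := mul_le_mul hk1 hj1 hj0 (Real.exp_pos _).le
    _ = Real.exp (lam * t) ^ 2 := by ring

/-- The Laplace hypotheses of `IntegerScrewResolventLaplace` for a symmetric `S` with form bound `ν < a`. -/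
theorem laplaceHyp_of_form_le {S : Matrix ι ι ℝ} (hS : S.IsHermitian) {ν a : ℝ}
    (hform : ∀ c : ι → ℝ, c ⬝ᵥ (S *ᵥ c) ≤ ν * (c ⬝ᵥ c)) (ha : ν < a) :
    (∀ k j : ι, IntegrableOn (fun t : ℝ => Real.exp (-(a * t)) * (exp (t • S)) k j) (Ioi 0)) ∧
      ∀ k j : ι, Tendsto (fun t : ℝ => Real.exp (-(a * t)) * (exp (t • S)) k j) atTop (nhds 0) :=
  laplaceHyp_of_growth S (C := 1) ha fun t ht k j => by
    rw [one_mul]; exact abs_exp_smul_apply_le_of_form_le hS hform ht k j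

/-- **Resolvent = Laplace transform for a symmetric matrix**, for every `a` above a form bound:
`((a·1 − S)⁻¹)_{ij} = ∫₀^∞ e^{−at}(e^{tS})_{ij} dt`. -/
theorem inv_apply_eq_integral_laplace_of_form_le {S : Matrix ι ι ℝ} (hS : S.IsHermitian) {ν a : ℝ}
    (hform : ∀ c : ι → ℝ, c ⬝ᵥ (S *ᵥ c) ≤ ν * (c ⬝ᵥ c)) (ha : ν < a) (i j : ι) :
    ((a • (1 : Matrix ι ι ℝ) - S)⁻¹) i j = ∫ t in Ioi (0 : ℝ), Real.exp (-(a * t)) * (exp (t • S)) i j :=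
  inv_apply_eq_integral_laplace S a (laplaceHyp_of_form_le hS hform ha).1
    (laplaceHyp_of_form_le hS hform ha).2 i j

end Symmetric

/-! ### The window floor of the coupling matrix -/

/-- **PIVOT-LAW 13.10 (v)**: for `a > ν`, `ν` a bound of the form of `N_M`, the window floor is positive,
attained, and `1/f_M(a) = ∫₀^∞ e^{−at}(e^{tN_M})₁₁ dt`. -/
theorem windowFloor_inv_eq_integral {M : ℕ} (h1 : 1 ∈ Finset.Icc 1 M) {ν a : ℝ}
    (hform : ∀ v : ↥(Finset.Icc 1 M) → ℝ, v ⬝ᵥ (couplingMatrix M *ᵥ v) ≤ ν * (v ⬝ᵥ v)) (ha : ν < a) :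
    (windowFloor M a)⁻¹ =
      ∫ t in Ioi (0 : ℝ), Real.exp (-(a * t)) * (exp (t • couplingMatrix M)) ⟨1, h1⟩ ⟨1, h1⟩ := by
  have hpd := windowMatrix_posDef_of_form_le _ (couplingMatrix_isHermitian M) hform ha
  rw [windowFloor_eq_inv_resolvent h1 hpd, inv_inv]
  exact inv_apply_eq_integral_laplace_of_form_le (couplingMatrix_isHermitian M) hform ha _ _

/-- The identity for every `M ≥ 1` and every `a > log M + 6` (LEMMA N (i)). -/
theorem windowFloor_inv_eq_integral_of_lt {M : ℕ} (h1 : 1 ∈ Finset.Icc 1 M) {a : ℝ}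
    (ha : Real.log M + 6 < a) :
    (windowFloor M a)⁻¹ =
      ∫ t in Ioi (0 : ℝ), Real.exp (-(a * t)) * (exp (t • couplingMatrix M)) ⟨1, h1⟩ ⟨1, h1⟩ :=
  windowFloor_inv_eq_integral h1 (couplingMatrix_form_le_log_add_six M) ha

/-- **The identity at `a = log M + s` for every `s ≥ 0`, all large `M`** (PROP. N2: the form of `N_M` is
`≤ (log M − γ/2)‖c‖²` eventually): `1/f_M(log M + s) = ∫₀^∞ e^{−(log M + s)t}(e^{tN_M})₁₁ dt`. -/
theorem windowFloor_inv_eq_integral_eventually :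
    ∀ᶠ M : ℕ in atTop, ∀ (h1 : 1 ∈ Finset.Icc 1 M) (s : ℝ), 0 ≤ s →
      (windowFloor M (Real.log M + s))⁻¹ =
        ∫ t in Ioi (0 : ℝ), Real.exp (-((Real.log M + s) * t)) *
          (exp (t • couplingMatrix M)) ⟨1, h1⟩ ⟨1, h1⟩ := by
  have hγ : 0 < Real.eulerMascheroniConstant := by
    linarith [Real.one_half_lt_eulerMascheroniConstant]
  filter_upwards [couplingMatrix_form_le_eventually (half_pos hγ)] with M hM h1 s hs
  exact windowFloor_inv_eq_integral h1 hM (by linarith)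

/-- Positivity of the floor at `a = log M + s`, `s ≥ 0`, for all large `M`. -/
theorem windowFloor_pos_eventually :
    ∀ᶠ M : ℕ in atTop, ∀ (h1 : 1 ∈ Finset.Icc 1 M) (s : ℝ), 0 ≤ s → 0 < windowFloor M (Real.log M + s) := by
  filter_upwards [windowMatrix_posDef_eventually] with M hM h1 s hs
  exact windowFloor_pos h1 (hM s hs)

/-- **Spectral tail bound** for the coupling semigroup: if the form of `N_M` is `≤ ν‖c‖²` then
`(e^{(t+1)N_M})_{kk} ≤ e^{νt}·(e^{N_M})_{kk}` for `t ≥ 0` (the input of PIVOT-LAW 13.45 for the range `t ≥ 1`). -/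
theorem exp_couplingMatrix_apply_self_le_tail {M : ℕ} {ν : ℝ}
    (hform : ∀ v : ↥(Finset.Icc 1 M) → ℝ, v ⬝ᵥ (couplingMatrix M *ᵥ v) ≤ ν * (v ⬝ᵥ v))
    {t : ℝ} (ht : 0 ≤ t) (k : ↥(Finset.Icc 1 M)) :
    (exp ((t + 1) • couplingMatrix M)) k k ≤ Real.exp (ν * t) * (exp ((1 : ℝ) • couplingMatrix M)) k k :=
  exp_add_smul_apply_self_le (couplingMatrix_isHermitian M) hform ht 1 k

/-- The diagonal of the coupling semigroup is non-negative. -/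
theorem exp_couplingMatrix_apply_self_nonneg (M : ℕ) (t : ℝ) (k : ↥(Finset.Icc 1 M)) :
    0 ≤ (exp (t • couplingMatrix M)) k k :=
  exp_smul_apply_self_nonneg (couplingMatrix_isHermitian M) t k

end Summit.RiemannHypothesis.RiemannHypothesis.Theorems.IntegerScrew

end
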